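import Mathlib
import HarnessLib
import Literature.Topology.PlaneTopology.JordanCurve
import Literature.Topology.PlaneTopology.JordanCurveProofs
import Summits.NavierStokesRegularity.NavierStokesRegularity.Theorems.PoloidalWindowDoorPoloidalWindowRigidityLevelTube

/-!
# Route `PoloidalWindowDoor`, crux `PoloidalWindowRigidity` (K2, stmt-NavierStokesRegularity-19708) — LINE 14 `loop_island` (ns-idea-8 g7),
# STUB J `stub_jordanOrbit`: JORDAN SEPARATION for a non-stationary periodic orbit of a horizontal `C¹` field — PROVED, from the tree's
# Jordan curve theorem (`Literature.Topology.PlaneTopology.JordanCurveTheorem_holds`, Eilenberg's continuous-logarithm proof)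

Cell ns-regularity-ideate, seat ns-poloidal-K2-p2 g12 (stub-worker on K2; `--supports` the crux item).  Statement VERBATIM
`Cruxes/PoloidalWindowRigidity/Lines/loop_island.lean` (ad8f96e88fc9) l.126–132; the line card calls J «fact-grade, Mathlib has no Jordan
curve theorem» — but the TREE has one (`Literature/Topology/PlaneTopology/JordanCurveProofs.lean`), so J is an ordinary theorem.

PROOF.  (1) MINIMAL PERIOD (`exists_minimal_period`): the set of `τ` with `γ τ = γ 0` is, by uniqueness of solutions (`X` is Lipschitz on a
ball containing the bounded orbit, `ODE_solution_unique_univ`), exactly the set of periods of `γ`; it is a closed additive subgroup of `ℝ`, not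
dense (else `γ` would be constant and `X (γ 0) = γ′(0) = 0`), hence cyclic (`AddSubgroup.dense_or_cyclic`) with a generator `T₀ > 0`, and
`γ` is injective on `[0, T₀)`.  (2) The orbit is planar (`…LevelTube.orbit_planar`), so `s ↦ (γ(T₀s)₀, γ(T₀s)₁) ∈ ℂ` is a continuous
`1`-periodic map injective on `[0,1)`; the tree's `JordanCurveTheorem.of_periodic JordanCurveTheorem_holds` gives a BOUNDED open connected
`U ⊂ ℂ` disjoint from the curve with `frontier U = ` the curve.  (3) `O := {y : (y₀,y₁) ∈ U, |y₂ − z₀| < 1}` (the cylinder over the inside)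
is open, bounded, meets the plane `{y₂ = z₀}` of the orbit, and a point of `closure O` in that plane outside `O` projects to
`closure U ∖ U = frontier U`, i.e. lies on `range γ`.

WHAT THIS IS NOT: not a claim about Navier–Stokes regularity — planar topology for one stub of an ideator line of a door route (bears_on
LADDER-NS N0, rung N0-LocalTubeDoorPoloidal); with D/Y/Z (landed) the line's `noLoops_of_noIslands` becomes unconditional; the residues
`stub_noIslands` (= ⟨27893⟩ in scalar form), S0, HL3′ stay OPEN; crux 19708 OPEN.
-/

noncomputable section

-- the summit and its single sub-problem share the name (CONVENTIONS §1), as in every Theorems file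
set_option linter.dupNamespace false

namespace Summit.NavierStokesRegularity.NavierStokesRegularity.Theorems.PoloidalWindowDoorPoloidalWindowRigidityJordanOrbit

open MeasureTheory Set Function Filter Topology Metric
open scoped RealInnerProductSpace InnerProductSpace NNReal
open Literature.Topology.PlaneTopology
open Summit.NavierStokesRegularity.NavierStokesRegularity.Theorems.PoloidalWindowDoorPoloidalWindowRigidityLevelTube

variable {X : EuclideanSpace ℝ (Fin 3) → EuclideanSpace ℝ (Fin 3)} {γ : ℝ → EuclideanSpace ℝ (Fin 3)} {ℓ : ℝ}

/-- **Uniqueness transport along the orbit**: if `γ a = γ b` for an orbit of a `C¹` field then `b − a` is a period of `γ`. [folklore] -/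
theorem periodic_of_apply_eq (hX : ContDiff ℝ 1 X) (hγ : ∀ θ, HasDerivAt γ (X (γ θ)) θ) (hℓ : 0 < ℓ)
    (hper : ∀ θ, γ (θ + ℓ) = γ θ) {a b : ℝ} (hab : γ a = γ b) (θ : ℝ) : γ (θ + (b - a)) = γ θ := by
  have hcont : Continuous γ := continuous_iff_continuousAt.2 fun t => (hγ t).continuousAt
  obtain ⟨R, hR⟩ := (isCompact_range_of_periodic hcont hℓ hper).isBounded.subset_closedBall 0
  set s : Set (EuclideanSpace ℝ (Fin 3)) := closedBall 0 (R + 1) with hs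
  have hγs : ∀ t, γ t ∈ s := fun t => closedBall_subset_closedBall (by linarith) (hR ⟨t, rfl⟩)
  obtain ⟨M, hM⟩ := (isCompact_closedBall (0 : EuclideanSpace ℝ (Fin 3)) (R + 1)).exists_bound_of_continuousOn
    ((hX.continuous_fderiv one_ne_zero).continuousOn)
  have hlip : LipschitzOnWith (Real.toNNReal M) X s := by
    refine (convex_closedBall _ _).lipschitzOnWith_of_nnnorm_fderiv_le (fun x _ => (hX.differentiable one_ne_zero) x) (fun x hx => ?_)
    have h := hM x hx
    exact_mod_cast (show ‖fderiv ℝ X x‖ ≤ (Real.toNNReal M : ℝ) from h.trans (Real.le_coe_toNNReal M))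
  -- both `θ ↦ γ (θ + a)` and `θ ↦ γ (θ + b)` solve the ODE with the same value at `0`
  have hsol : ∀ c : ℝ, ∀ t, HasDerivAt (fun θ => γ (θ + c)) (X (γ (t + c))) t := fun c t =>
    (hγ (t + c)).comp_add_const t c
  have huniq := ODE_solution_unique_univ (v := fun _ => X) (s := fun _ => s) (t₀ := 0) (f := fun θ => γ (θ + a))
    (g := fun θ => γ (θ + b)) (fun _ => hlip) (fun t => ⟨hsol a t, hγs _⟩) (fun t => ⟨hsol b t, hγs _⟩) (by simpa using hab)
  have h := congrFun huniq (θ - a)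
  simp only [sub_add_cancel] at h
  rw [h]; congr 1; ring

/-- **MINIMAL PERIOD AND INJECTIVITY** of a non-stationary periodic orbit of a `C¹` field: some `T₀ > 0` is a period and `γ` is injective on
`[0, T₀)` (the period group is a closed, non-dense subgroup of `ℝ`, hence cyclic). [folklore] -/
theorem exists_minimal_period (hX : ContDiff ℝ 1 X) (hγ : ∀ θ, HasDerivAt γ (X (γ θ)) θ) (hℓ : 0 < ℓ)
    (hper : ∀ θ, γ (θ + ℓ) = γ θ) (hne : X (γ 0) ≠ 0) :
    ∃ T₀ : ℝ, 0 < T₀ ∧ (∀ θ, γ (θ + T₀) = γ θ) ∧ Set.InjOn γ (Set.Ico 0 T₀) := by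
  have hcont : Continuous γ := continuous_iff_continuousAt.2 fun t => (hγ t).continuousAt
  -- the period group
  let G : AddSubgroup ℝ :=
    { carrier := {τ | ∀ θ, γ (θ + τ) = γ θ}
      zero_mem' := by intro θ; simp
      add_mem' := by
        intro a b ha hb θ
        rw [← add_assoc, hb (θ + a), ha θ]
      neg_mem' := by
        intro a ha θ
        have h := ha (θ + -a)
        rw [neg_add_cancel_right] at h
        exact h.symm }
  have hGmem : ∀ τ, τ ∈ G ↔ ∀ θ, γ (θ + τ) = γ θ := fun τ => Iff.rfl
  have hGclosed : IsClosed (G : Set ℝ) := by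
    have : (G : Set ℝ) = ⋂ θ : ℝ, {τ | γ (θ + τ) = γ θ} := by ext τ; simp [hGmem]
    rw [this]
    exact isClosed_iInter fun θ => isClosed_eq (hcont.comp (continuous_const.add continuous_id)) continuous_const
  have hℓG : ℓ ∈ G := hper
  -- not dense: otherwise `γ` is constant
  rcases AddSubgroup.dense_or_cyclic G with hdense | ⟨g, hg⟩
  · exfalso
    have hall : ∀ τ, τ ∈ G := fun τ => by
      have : τ ∈ closure (G : Set ℝ) := by rw [hdense.closure_eq]; exact mem_univ _
      rwa [hGclosed.closure_eq] at this
    have hconstfun : γ = fun _ => γ 0 := funext fun τ => by simpa using (hall τ) 0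
    have h0 : HasDerivAt γ 0 0 := by rw [hconstfun]; exact hasDerivAt_const 0 _
    exact hne ((hγ 0).unique h0 ▸ rfl)
  · -- cyclic: generator `g ≠ 0`; `T₀ := |g|`
    have hℓ' : ℓ ∈ AddSubgroup.closure {g} := hg ▸ hℓG
    obtain ⟨n, hn⟩ := AddSubgroup.mem_closure_singleton.1 hℓ'
    have hg0 : g ≠ 0 := by rintro rfl; simp at hn; linarith
    have hgG : g ∈ G := by rw [hg]; exact AddSubgroup.mem_closure_singleton.2 ⟨1, one_zsmul g⟩
    have hTG : |g| ∈ G := by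
      rcases abs_choice g with h | h
      · rw [h]; exact hgG
      · rw [h]; exact G.neg_mem hgG
    refine ⟨|g|, abs_pos.2 hg0, (hGmem _).1 hTG, ?_⟩
    intro a ha b hb hab
    -- `b - a` is a period, hence a multiple of `g`, hence `0`
    have hperiod : (b - a) ∈ G := (hGmem _).2 (periodic_of_apply_eq hX hγ hℓ hper hab)
    rw [hg] at hperiod
    obtain ⟨k, hk⟩ := AddSubgroup.mem_closure_singleton.1 hperiod
    have hlt : |b - a| < |g| := by
      rw [abs_lt]; constructor <;> linarith [ha.1, ha.2, hb.1, hb.2]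
    have hk0 : k = 0 := by
      by_contra hk0
      have h1 : (1 : ℝ) ≤ |(k : ℝ)| := by
        rw [← Int.cast_abs]; exact_mod_cast Int.one_le_abs hk0
      have h2 : |b - a| = |(k : ℝ)| * |g| := by rw [← hk, zsmul_eq_mul, abs_mul]
      have h3 : |g| ≤ |(k : ℝ)| * |g| := le_mul_of_one_le_left (abs_nonneg _) h1
      linarith
    rw [hk0, zero_zsmul] at hk
    linarith

/-- **STUB J `stub_jordanOrbit` of LINE 14 `loop_island` (VERBATIM): JORDAN SEPARATION for a periodic orbit of a horizontal `C¹` field.**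
See the module docstring for the proof. -/
theorem stub_jordanOrbit :
    ∀ (X : EuclideanSpace ℝ (Fin 3) → EuclideanSpace ℝ (Fin 3)), ContDiff ℝ 1 X → (∀ y, X y 2 = 0) →
      ∀ (γ : ℝ → EuclideanSpace ℝ (Fin 3)) (ℓ : ℝ), 0 < ℓ → (∀ θ, HasDerivAt γ (X (γ θ)) θ) → (∀ θ, γ (θ + ℓ) = γ θ) →
        X (γ 0) ≠ 0 →
        ∃ O : Set (EuclideanSpace ℝ (Fin 3)), IsOpen O ∧ Bornology.IsBounded O ∧ (∃ y ∈ O, y 2 = γ 0 2) ∧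
          ∀ y ∈ closure O, y 2 = γ 0 2 → y ∉ O → y ∈ Set.range γ := by
  intro X hX hX2 γ ℓ hℓ hγ hper hne
  have hcont : Continuous γ := continuous_iff_continuousAt.2 fun t => (hγ t).continuousAt
  have hpl : ∀ θ, γ θ 2 = γ 0 2 := orbit_planar hX2 hγ
  set z₀ : ℝ := γ 0 2 with hz₀
  -- (1) minimal period
  obtain ⟨T₀, hT₀, hperT, hinj⟩ := exists_minimal_period hX hγ hℓ hper hne
  -- (2) the planar curve in `ℂ`
  set c : ℝ → ℂ := fun s => ⟨γ (T₀ * s) 0, γ (T₀ * s) 1⟩ with hc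
  have hcc : Continuous c := by
    have h0 : Continuous fun s => γ (T₀ * s) 0 :=
      (EuclideanSpace.proj (𝕜 := ℝ) (0 : Fin 3)).continuous.comp (hcont.comp (continuous_const.mul continuous_id))
    have h1 : Continuous fun s => γ (T₀ * s) 1 :=
      (EuclideanSpace.proj (𝕜 := ℝ) (1 : Fin 3)).continuous.comp (hcont.comp (continuous_const.mul continuous_id))
    exact (Complex.equivRealProdCLM.symm.continuous.comp (h0.prodMk h1)).congr fun s => rfl
  have hcp : Function.Periodic c 1 := fun s => by
    simp only [hc, mul_add, mul_one, hperT]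
  have hcinj : Set.InjOn c (Set.Ico 0 1) := by
    intro a ha b hb hab
    have h0 : γ (T₀ * a) 0 = γ (T₀ * b) 0 := by simpa [hc] using congrArg Complex.re hab
    have h1 : γ (T₀ * a) 1 = γ (T₀ * b) 1 := by simpa [hc] using congrArg Complex.im hab
    have heq : γ (T₀ * a) = γ (T₀ * b) := by
      ext i; fin_cases i
      · exact h0
      · exact h1
      · show γ (T₀ * a) 2 = γ (T₀ * b) 2; rw [hpl, hpl]
    have ha' : T₀ * a ∈ Set.Ico 0 T₀ := ⟨by nlinarith [ha.1], by nlinarith [ha.2]⟩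
    have hb' : T₀ * b ∈ Set.Ico 0 T₀ := ⟨by nlinarith [hb.1], by nlinarith [hb.2]⟩
    have := hinj ha' hb' heq
    exact mul_left_cancel₀ hT₀.ne' this
  -- Jordan
  obtain ⟨U, V, hUo, -, hUc, -, -, hUV, hfU, -, hUbdd, -⟩ :=
    JordanCurveTheorem.of_periodic JordanCurveTheorem_holds hcc hcp hcinj
  have hUne : U.Nonempty := hUc.nonempty
  have hUsub : U ⊆ (range c)ᶜ := fun z hz => hUV ▸ Or.inl hz
  -- (3) the cylinder over the inside
  set pr : EuclideanSpace ℝ (Fin 3) → ℂ := fun y => ⟨y 0, y 1⟩ with hpr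
  have hprc : Continuous pr := by
    have h0 : Continuous fun y : EuclideanSpace ℝ (Fin 3) => y 0 := (EuclideanSpace.proj (𝕜 := ℝ) (0 : Fin 3)).continuous
    have h1 : Continuous fun y : EuclideanSpace ℝ (Fin 3) => y 1 := (EuclideanSpace.proj (𝕜 := ℝ) (1 : Fin 3)).continuous
    exact (Complex.equivRealProdCLM.symm.continuous.comp (h0.prodMk h1)).congr fun y => rfl
  have h2c : Continuous fun y : EuclideanSpace ℝ (Fin 3) => y 2 := (EuclideanSpace.proj (𝕜 := ℝ) (2 : Fin 3)).continuous
  set O : Set (EuclideanSpace ℝ (Fin 3)) := {y | pr y ∈ U ∧ |y 2 - z₀| < 1} with hO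
  refine ⟨O, ?_, ?_, ?_, ?_⟩
  · rw [hO, Set.setOf_and]
    exact (hUo.preimage hprc).inter (isOpen_lt (continuous_abs.comp (h2c.sub continuous_const)) continuous_const)
  · obtain ⟨R, hR⟩ := hUbdd.subset_closedBall 0
    refine (isBounded_iff_subset_closedBall 0).2 ⟨|R| + (|z₀| + 1), fun y hy => mem_closedBall_zero_iff.2 ?_⟩
    have hq : ‖pr y‖ ≤ |R| := by
      have := hR hy.1; rw [mem_closedBall, dist_zero_right] at this; exact this.trans (le_abs_self R)
    have hq2 : y 0 ^ 2 + y 1 ^ 2 ≤ |R| ^ 2 := by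
      have e : y 0 ^ 2 + y 1 ^ 2 = ‖pr y‖ ^ 2 := by
        rw [Complex.sq_norm, Complex.normSq_apply]; simp only [hpr]; ring
      rw [e]; exact pow_le_pow_left₀ (norm_nonneg _) hq 2
    have h2 : |y 2| ≤ |z₀| + 1 := by
      have h := abs_add_le (y 2 - z₀) z₀
      rw [sub_add_cancel] at h
      linarith [hy.2.le]
    have h2' : y 2 ^ 2 ≤ (|z₀| + 1) ^ 2 := by
      rw [← sq_abs (y 2)]; exact pow_le_pow_left₀ (abs_nonneg _) h2 2
    have hn : ‖y‖ ^ 2 = y 0 ^ 2 + y 1 ^ 2 + y 2 ^ 2 := by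
      rw [EuclideanSpace.norm_eq, Real.sq_sqrt (Finset.sum_nonneg fun i _ => sq_nonneg _), Fin.sum_univ_three]
      simp
    have hA : 0 ≤ |R| + (|z₀| + 1) := by positivity
    have hS : ‖y‖ ^ 2 ≤ (|R| + (|z₀| + 1)) ^ 2 := by
      rw [hn]
      nlinarith [hq2, h2', mul_nonneg (abs_nonneg R) (by positivity : (0 : ℝ) ≤ |z₀| + 1)]
    have h := Real.sqrt_le_sqrt hS
    rwa [Real.sqrt_sq (norm_nonneg _), Real.sqrt_sq hA] at h
  · obtain ⟨u, hu⟩ := hUne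
    refine ⟨EuclideanSpace.single 0 u.re + EuclideanSpace.single 1 u.im + EuclideanSpace.single 2 z₀, ⟨?_, by simp⟩, by simp [hz₀]⟩
    have : pr (EuclideanSpace.single 0 u.re + EuclideanSpace.single 1 u.im + EuclideanSpace.single 2 z₀) = u := by
      apply Complex.ext <;> simp [hpr]
    rw [this]; exact hu
  · intro y hy hy2 hyO
    -- `pr y ∈ closure U \ U = frontier U = range c`
    have hq_cl : pr y ∈ closure U := by
      have h1 : pr '' O ⊆ U := by rintro _ ⟨y', hy', rfl⟩; exact hy'.1
      exact closure_mono h1 (image_closure_subset_closure_image hprc ⟨y, hy, rfl⟩)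
    have hq_nU : pr y ∉ U := fun h => hyO ⟨h, by rw [hy2, hz₀, sub_self, abs_zero]; exact one_pos⟩
    have hq_fr : pr y ∈ frontier U := by rw [hUo.frontier_eq]; exact ⟨hq_cl, hq_nU⟩
    rw [hfU] at hq_fr
    obtain ⟨s, hs⟩ := hq_fr
    refine ⟨T₀ * s, ?_⟩
    have h0 : γ (T₀ * s) 0 = y 0 := by simpa [hc, hpr] using congrArg Complex.re hs
    have h1 : γ (T₀ * s) 1 = y 1 := by simpa [hc, hpr] using congrArg Complex.im hs
    ext i; fin_cases i
    · exact h0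
    · exact h1
    · show γ (T₀ * s) 2 = y 2; rw [hpl, hy2]

end Summit.NavierStokesRegularity.NavierStokesRegularity.Theorems.PoloidalWindowDoorPoloidalWindowRigidityJordanOrbit
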